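import Summits.AnomalousDissipation.AnomalousDissipation.Theorems.SolenoidalFractalHomogenisationRealisedQuasiStaticCellLawComovingPairTransport
import Summits.AnomalousDissipation.AnomalousDissipation.Theorems.SolenoidalFractalHomogenisationNearCommutingProduct
import HarnessLib

/-!
# K2R `RealisedQuasiStaticCellLaw`, line `floquet-bloch`, stub `stub_lowSectorDecay` (S1D): the metric reset of the
# co-moving pair weights from the near-commuting product estimate (W-near regime)

Summits-side helper file (everything proved; no definitions, no named facts; `--supports stmt-AnomalousDissipation-20446`).
The END hypothesis of `comoving_end` (…ComovingPairTransport) — an expansion bound `e^{2λ̄P}|z|² ≤ |C_{k₀} z|²` for the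
full-period transport `C_{k₀} = N₀ N₁ ⋯ N_{k₀−1}`, `N_j = R_jᵀ diag(e^{X_o,j}, e^{X_i,j}) R_j` — from a LOWER bound `μ`
of the quadratic form `Σ_j (X_o,j (R_j z)₁² + X_i,j (R_j z)₂²)` (isotropy of the word up to a finite-`n` defect) and the
smallness `Σ_j (e^{X_o,j + X_i,j} − 1) ≤ 1`: `|C_{k₀} z| ≥ (1 + μ − (Σ_j (e^{X_o,j+X_i,j} − 1))²)|z|`
(`comoving_transport_lower`). Proof: the `N_j` are realised as symmetric continuous linear maps on `EuclideanSpace ℝ (Fin 2)`,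
the ordered product is `1 + Σ_j(N_j − 1)` up to `(Σ_j‖N_j − 1‖)²` (`norm_listProd_one_sub_sub_le`, …NearCommutingProduct, F3),
and the main term is bounded below through its quadratic form.
-/

set_option linter.dupNamespace false

noncomputable section

namespace Summit.AnomalousDissipation.AnomalousDissipation.Theorems.SolenoidalFractalHomogenisation.RealisedQuasiStaticCellLaw

open Set Function Matrix
open scoped InnerProductSpace Matrix
open Literature.Analysis.FluidPDE Literature.Analysis.FluidPDE.LatticeShear

variable {k₀ : ℕ}

/-- The real inner product on `EuclideanSpace ℝ (Fin 2)` in coordinates. -/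
theorem euclid2_inner (x y : EuclideanSpace ℝ (Fin 2)) : ⟪x, y⟫_ℝ = x 0 * y 0 + x 1 * y 1 := by
  rw [EuclideanSpace.inner_eq_star_dotProduct]; simp [dotProduct, Fin.sum_univ_two, mul_comm]

/-- The `2 × 2` matrix operator and its components. -/
theorem euclid2_toLin_apply (a b c d : ℝ) (z : EuclideanSpace ℝ (Fin 2)) :
    (LinearMap.toContinuousLinearMap (Matrix.toEuclideanLin !![a, b; c, d]) z) 0 = a * z 0 + b * z 1 ∧
      (LinearMap.toContinuousLinearMap (Matrix.toEuclideanLin !![a, b; c, d]) z) 1 = c * z 0 + d * z 1 := by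
  constructor <;> simp [Matrix.mulVec, dotProduct, Fin.sum_univ_two]

/-- **Lower bound of the full-period transport from the near-commuting product estimate.** -/
theorem comoving_transport_lower (W : LatticeWord k₀) (Λ d0 σo σi g₁ rc rs : Fin k₀ → ℝ) (c₁₁ c₁₂ c₂₁ c₂₂ : ℕ → ℝ)
    (hΛ : ∀ j, 0 ≤ Λ j) (hd0 : ∀ j, 0 ≤ d0 j) (hσo : ∀ j, 0 ≤ σo j) (hσi : ∀ j, 0 ≤ σi j)
    (hrot : ∀ j, rc j ^ 2 + rs j ^ 2 = 1) (hC0 : c₁₁ 0 = 1 ∧ c₁₂ 0 = 0 ∧ c₂₁ 0 = 0 ∧ c₂₂ 0 = 1)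
    (hCsucc : ∀ j : Fin k₀, c₁₁ ((j : ℕ) + 1) = c₁₁ j * (rc j ^ 2 * Real.exp (Λ j * (d0 j * (W.phase j).τ + σo j * g₁ j ^ 2 * ((W.phase j).τ * (1 - 4 * W.ramp / 3)))) + rs j ^ 2 * Real.exp (Λ j * (d0 j * (W.phase j).τ + σi j * g₁ j ^ 2 * ((W.phase j).τ * (1 - 4 * W.ramp / 3))))) + c₁₂ j * (rc j * rs j * (Real.exp (Λ j * (d0 j * (W.phase j).τ + σo j * g₁ j ^ 2 * ((W.phase j).τ * (1 - 4 * W.ramp / 3)))) - Real.exp (Λ j * (d0 j * (W.phase j).τ + σi j * g₁ j ^ 2 * ((W.phase j).τ * (1 - 4 * W.ramp / 3)))))) ∧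
        c₁₂ ((j : ℕ) + 1) = c₁₁ j * (rc j * rs j * (Real.exp (Λ j * (d0 j * (W.phase j).τ + σo j * g₁ j ^ 2 * ((W.phase j).τ * (1 - 4 * W.ramp / 3)))) - Real.exp (Λ j * (d0 j * (W.phase j).τ + σi j * g₁ j ^ 2 * ((W.phase j).τ * (1 - 4 * W.ramp / 3)))))) + c₁₂ j * (rs j ^ 2 * Real.exp (Λ j * (d0 j * (W.phase j).τ + σo j * g₁ j ^ 2 * ((W.phase j).τ * (1 - 4 * W.ramp / 3)))) + rc j ^ 2 * Real.exp (Λ j * (d0 j * (W.phase j).τ + σi j * g₁ j ^ 2 * ((W.phase j).τ * (1 - 4 * W.ramp / 3))))) ∧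
        c₂₁ ((j : ℕ) + 1) = c₂₁ j * (rc j ^ 2 * Real.exp (Λ j * (d0 j * (W.phase j).τ + σo j * g₁ j ^ 2 * ((W.phase j).τ * (1 - 4 * W.ramp / 3)))) + rs j ^ 2 * Real.exp (Λ j * (d0 j * (W.phase j).τ + σi j * g₁ j ^ 2 * ((W.phase j).τ * (1 - 4 * W.ramp / 3))))) + c₂₂ j * (rc j * rs j * (Real.exp (Λ j * (d0 j * (W.phase j).τ + σo j * g₁ j ^ 2 * ((W.phase j).τ * (1 - 4 * W.ramp / 3)))) - Real.exp (Λ j * (d0 j * (W.phase j).τ + σi j * g₁ j ^ 2 * ((W.phase j).τ * (1 - 4 * W.ramp / 3)))))) ∧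
        c₂₂ ((j : ℕ) + 1) = c₂₁ j * (rc j * rs j * (Real.exp (Λ j * (d0 j * (W.phase j).τ + σo j * g₁ j ^ 2 * ((W.phase j).τ * (1 - 4 * W.ramp / 3)))) - Real.exp (Λ j * (d0 j * (W.phase j).τ + σi j * g₁ j ^ 2 * ((W.phase j).τ * (1 - 4 * W.ramp / 3)))))) + c₂₂ j * (rs j ^ 2 * Real.exp (Λ j * (d0 j * (W.phase j).τ + σo j * g₁ j ^ 2 * ((W.phase j).τ * (1 - 4 * W.ramp / 3)))) + rc j ^ 2 * Real.exp (Λ j * (d0 j * (W.phase j).τ + σi j * g₁ j ^ 2 * ((W.phase j).τ * (1 - 4 * W.ramp / 3))))))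
    (μ : ℝ) (hiso : ∀ z₁ z₂ : ℝ, μ * (z₁ ^ 2 + z₂ ^ 2) ≤
      ∑ j : Fin k₀, ((Λ j * (d0 j * (W.phase j).τ + σo j * g₁ j ^ 2 * ((W.phase j).τ * (1 - 4 * W.ramp / 3)))) * (rc j * z₁ + rs j * z₂) ^ 2 + (Λ j * (d0 j * (W.phase j).τ + σi j * g₁ j ^ 2 * ((W.phase j).τ * (1 - 4 * W.ramp / 3)))) * (-rs j * z₁ + rc j * z₂) ^ 2))
    (hsmallX : ∑ j : Fin k₀, (Real.exp ((Λ j * (d0 j * (W.phase j).τ + σo j * g₁ j ^ 2 * ((W.phase j).τ * (1 - 4 * W.ramp / 3)))) + (Λ j * (d0 j * (W.phase j).τ + σi j * g₁ j ^ 2 * ((W.phase j).τ * (1 - 4 * W.ramp / 3))))) - 1) ≤ 1)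
    (hpos : 0 ≤ 1 + μ - (∑ j : Fin k₀, (Real.exp ((Λ j * (d0 j * (W.phase j).τ + σo j * g₁ j ^ 2 * ((W.phase j).τ * (1 - 4 * W.ramp / 3)))) + (Λ j * (d0 j * (W.phase j).τ + σi j * g₁ j ^ 2 * ((W.phase j).τ * (1 - 4 * W.ramp / 3))))) - 1)) ^ 2) :
    ∀ z₁ z₂ : ℝ, (1 + μ - (∑ j : Fin k₀, (Real.exp ((Λ j * (d0 j * (W.phase j).τ + σo j * g₁ j ^ 2 * ((W.phase j).τ * (1 - 4 * W.ramp / 3)))) + (Λ j * (d0 j * (W.phase j).τ + σi j * g₁ j ^ 2 * ((W.phase j).τ * (1 - 4 * W.ramp / 3))))) - 1)) ^ 2) ^ 2 * (z₁ ^ 2 + z₂ ^ 2) ≤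
      (c₁₁ k₀ * z₁ + c₁₂ k₀ * z₂) ^ 2 + (c₂₁ k₀ * z₁ + c₂₂ k₀ * z₂) ^ 2 := by
  classical
  intro z₁ z₂
  have euclid2_norm_sq : ∀ z : EuclideanSpace ℝ (Fin 2), ‖z‖ ^ 2 = z 0 ^ 2 + z 1 ^ 2 := fun z => by
    rw [EuclideanSpace.norm_sq_eq, Fin.sum_univ_two, Real.norm_eq_abs, Real.norm_eq_abs, sq_abs, sq_abs]
  -- abbreviations
  obtain ⟨Xo, hXo⟩ : ∃ X : Fin k₀ → ℝ, X = fun j => (Λ j * (d0 j * (W.phase j).τ + σo j * g₁ j ^ 2 * ((W.phase j).τ * (1 - 4 * W.ramp / 3)))) := ⟨_, rfl⟩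
  obtain ⟨Xi, hXi⟩ : ∃ X : Fin k₀ → ℝ, X = fun j => (Λ j * (d0 j * (W.phase j).τ + σi j * g₁ j ^ 2 * ((W.phase j).τ * (1 - 4 * W.ramp / 3)))) := ⟨_, rfl⟩
  have hXo0 : ∀ j, 0 ≤ Xo j := fun j => by rw [hXo]; exact comoving_X_nonneg W Λ d0 σo g₁ hΛ hd0 hσo j
  have hXi0 : ∀ j, 0 ≤ Xi j := fun j => by rw [hXi]; exact comoving_X_nonneg W Λ d0 σi g₁ hΛ hd0 hσi j
  have eXo : ∀ j, (Λ j * (d0 j * (W.phase j).τ + σo j * g₁ j ^ 2 * ((W.phase j).τ * (1 - 4 * W.ramp / 3)))) = Xo j := fun j => by rw [hXo]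
  have eXi : ∀ j, (Λ j * (d0 j * (W.phase j).τ + σi j * g₁ j ^ 2 * ((W.phase j).τ * (1 - 4 * W.ramp / 3)))) = Xi j := fun j => by rw [hXi]
  simp only [eXo, eXi] at hCsucc hiso hsmallX hpos ⊢
  obtain ⟨S, hS⟩ : ∃ S : ℝ, S = ∑ j : Fin k₀, (Real.exp (Xo j + Xi j) - 1) := ⟨_, rfl⟩
  rw [← hS] at hsmallX hpos ⊢
  -- the factors as operators on the Euclidean plane
  obtain ⟨Nop, hNop⟩ : ∃ F : ℕ → (EuclideanSpace ℝ (Fin 2) →L[ℝ] EuclideanSpace ℝ (Fin 2)), F = fun i =>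
      if h : i < k₀ then LinearMap.toContinuousLinearMap (Matrix.toEuclideanLin
        !![rc ⟨i, h⟩ ^ 2 * Real.exp (Xo ⟨i, h⟩) + rs ⟨i, h⟩ ^ 2 * Real.exp (Xi ⟨i, h⟩),
            rc ⟨i, h⟩ * rs ⟨i, h⟩ * (Real.exp (Xo ⟨i, h⟩) - Real.exp (Xi ⟨i, h⟩));
          rc ⟨i, h⟩ * rs ⟨i, h⟩ * (Real.exp (Xo ⟨i, h⟩) - Real.exp (Xi ⟨i, h⟩)),
            rs ⟨i, h⟩ ^ 2 * Real.exp (Xo ⟨i, h⟩) + rc ⟨i, h⟩ ^ 2 * Real.exp (Xi ⟨i, h⟩)])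
      else 1 := ⟨_, rfl⟩
  have hNapp : ∀ m : ℕ, ∀ hm : m < k₀, ∀ z : EuclideanSpace ℝ (Fin 2),
      (Nop m z) 0 = (rc (⟨m, hm⟩ : Fin k₀) ^ 2 * Real.exp (Xo (⟨m, hm⟩ : Fin k₀)) + rs (⟨m, hm⟩ : Fin k₀) ^ 2 * Real.exp (Xi (⟨m, hm⟩ : Fin k₀))) * z 0 +
          rc (⟨m, hm⟩ : Fin k₀) * rs (⟨m, hm⟩ : Fin k₀) * (Real.exp (Xo (⟨m, hm⟩ : Fin k₀)) - Real.exp (Xi (⟨m, hm⟩ : Fin k₀))) * z 1 ∧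
        (Nop m z) 1 = rc (⟨m, hm⟩ : Fin k₀) * rs (⟨m, hm⟩ : Fin k₀) * (Real.exp (Xo (⟨m, hm⟩ : Fin k₀)) - Real.exp (Xi (⟨m, hm⟩ : Fin k₀))) * z 0 +
          (rs (⟨m, hm⟩ : Fin k₀) ^ 2 * Real.exp (Xo (⟨m, hm⟩ : Fin k₀)) + rc (⟨m, hm⟩ : Fin k₀) ^ 2 * Real.exp (Xi (⟨m, hm⟩ : Fin k₀))) * z 1 := by
    intro m hm z
    rw [hNop]
    simp only [dif_pos hm]
    exact euclid2_toLin_apply _ _ _ _ z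
  -- (f) the ordered product is the transport `C`
  have hprod : ∀ m : ℕ, m ≤ k₀ → ∀ z : EuclideanSpace ℝ (Fin 2),
      ((List.ofFn fun i : Fin m => Nop i).prod z) 0 = c₁₁ m * z 0 + c₁₂ m * z 1 ∧
        ((List.ofFn fun i : Fin m => Nop i).prod z) 1 = c₂₁ m * z 0 + c₂₂ m * z 1 := by
    intro m
    induction m with
    | zero =>
      intro _ z
      simp [hC0.1, hC0.2.1, hC0.2.2.1, hC0.2.2.2]
    | succ m ih =>
      intro hm z
      have hm' : m < k₀ := Nat.lt_of_succ_le hm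
      rw [List.ofFn_succ', List.prod_concat]
      change ((List.ofFn fun i : Fin m => Nop (i : ℕ)).prod (Nop m z)) 0 = _ ∧
        ((List.ofFn fun i : Fin m => Nop (i : ℕ)).prod (Nop m z)) 1 = _
      obtain ⟨h0, h1⟩ := ih hm'.le (Nop m z)
      obtain ⟨n0, n1⟩ := hNapp m hm' z
      have hC := hCsucc ⟨m, hm'⟩
      have hv : (((⟨m, hm'⟩ : Fin k₀) : ℕ)) = m := rfl
      rw [hv] at hC
      rw [h0, h1, n0, n1, hC.1, hC.2.1, hC.2.2.1, hC.2.2.2]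
      constructor <;> ring
  -- the near-identity parts `A_j = N_j − 1`
  obtain ⟨A, hA⟩ : ∃ A : Fin k₀ → (EuclideanSpace ℝ (Fin 2) →L[ℝ] EuclideanSpace ℝ (Fin 2)),
      A = fun j : Fin k₀ => Nop j - 1 := ⟨_, rfl⟩
  have hAapp : ∀ j : Fin k₀, ∀ z : EuclideanSpace ℝ (Fin 2),
      (A j z) 0 = rc j * ((Real.exp (Xo j) - 1) * (rc j * z 0 + rs j * z 1)) -
          rs j * ((Real.exp (Xi j) - 1) * (-rs j * z 0 + rc j * z 1)) ∧
        (A j z) 1 = rs j * ((Real.exp (Xo j) - 1) * (rc j * z 0 + rs j * z 1)) +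
          rc j * ((Real.exp (Xi j) - 1) * (-rs j * z 0 + rc j * z 1)) := by
    intro j z
    obtain ⟨n0, n1⟩ := hNapp j j.isLt z
    have e0 : (A j z) 0 = (Nop j z) 0 - z 0 := by rw [hA]; simp
    have e1 : (A j z) 1 = (Nop j z) 1 - z 1 := by rw [hA]; simp
    rw [e0, e1, n0, n1]
    constructor
    · linear_combination z 0 * hrot j
    · linear_combination z 1 * hrot j
  -- (b) operator norms
  have hAnorm : ∀ j : Fin k₀, ‖A j‖ ≤ Real.exp (Xo j + Xi j) - 1 := by
    intro j
    have he0 : 0 ≤ Real.exp (Xo j + Xi j) - 1 := by linarith [Real.add_one_le_exp (Xo j + Xi j), hXo0 j, hXi0 j]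
    refine ContinuousLinearMap.opNorm_le_bound _ he0 fun z => ?_
    obtain ⟨a0, a1⟩ := hAapp j z
    have hsq : ‖A j z‖ ^ 2 ≤ ((Real.exp (Xo j + Xi j) - 1) * ‖z‖) ^ 2 := by
      have hw : (rc j * z 0 + rs j * z 1) ^ 2 + (-rs j * z 0 + rc j * z 1) ^ 2 = z 0 ^ 2 + z 1 ^ 2 := by
        linear_combination (z 0 ^ 2 + z 1 ^ 2) * hrot j
      have hrotid : (rc j * ((Real.exp (Xo j) - 1) * (rc j * z 0 + rs j * z 1)) -
            rs j * ((Real.exp (Xi j) - 1) * (-rs j * z 0 + rc j * z 1))) ^ 2 +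
          (rs j * ((Real.exp (Xo j) - 1) * (rc j * z 0 + rs j * z 1)) +
            rc j * ((Real.exp (Xi j) - 1) * (-rs j * z 0 + rc j * z 1))) ^ 2 =
          (Real.exp (Xo j) - 1) ^ 2 * (rc j * z 0 + rs j * z 1) ^ 2 +
            (Real.exp (Xi j) - 1) ^ 2 * (-rs j * z 0 + rc j * z 1) ^ 2 := by
        linear_combination (((Real.exp (Xo j) - 1) * (rc j * z 0 + rs j * z 1)) ^ 2 +
          ((Real.exp (Xi j) - 1) * (-rs j * z 0 + rc j * z 1)) ^ 2) * hrot j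
      have lhs : ‖A j z‖ ^ 2 = (Real.exp (Xo j) - 1) ^ 2 * (rc j * z 0 + rs j * z 1) ^ 2 +
          (Real.exp (Xi j) - 1) ^ 2 * (-rs j * z 0 + rc j * z 1) ^ 2 := by rw [euclid2_norm_sq, a0, a1]; exact hrotid
      have rhs : ((Real.exp (Xo j + Xi j) - 1) * ‖z‖) ^ 2 =
          (Real.exp (Xo j + Xi j) - 1) ^ 2 * (rc j * z 0 + rs j * z 1) ^ 2 +
            (Real.exp (Xo j + Xi j) - 1) ^ 2 * (-rs j * z 0 + rc j * z 1) ^ 2 := by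
        rw [mul_pow, euclid2_norm_sq, ← hw]; ring
      have ho : 0 ≤ Real.exp (Xo j) - 1 := by linarith [Real.add_one_le_exp (Xo j), hXo0 j]
      have hi : 0 ≤ Real.exp (Xi j) - 1 := by linarith [Real.add_one_le_exp (Xi j), hXi0 j]
      have ho' : Real.exp (Xo j) - 1 ≤ Real.exp (Xo j + Xi j) - 1 := by
        linarith [Real.exp_le_exp.2 (le_add_of_nonneg_right (hXi0 j) : Xo j ≤ Xo j + Xi j)]
      have hi' : Real.exp (Xi j) - 1 ≤ Real.exp (Xo j + Xi j) - 1 := by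
        linarith [Real.exp_le_exp.2 (le_add_of_nonneg_left (hXo0 j) : Xi j ≤ Xo j + Xi j)]
      have t1 := mul_le_mul_of_nonneg_right (pow_le_pow_left₀ ho ho' 2) (sq_nonneg (rc j * z 0 + rs j * z 1))
      have t2 := mul_le_mul_of_nonneg_right (pow_le_pow_left₀ hi hi' 2) (sq_nonneg (-rs j * z 0 + rc j * z 1))
      rw [lhs, rhs]
      linarith [t1, t2]
    exact (pow_le_pow_iff_left₀ (norm_nonneg _) (mul_nonneg he0 (norm_nonneg _)) two_ne_zero).1 hsq
  -- (c) the main term through its quadratic form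
  obtain ⟨z, hz⟩ : ∃ z : EuclideanSpace ℝ (Fin 2), z = !₂[z₁, z₂] := ⟨_, rfl⟩
  have hz0 : z 0 = z₁ := by rw [hz]; simp
  have hz1 : z 1 = z₂ := by rw [hz]; simp
  have hmain : (1 + μ) * ‖z‖ ^ 2 ≤ ⟪(1 + ∑ j, A j) z, z⟫_ℝ := by
    have happ : (1 + ∑ j, A j) z = z + ∑ j, A j z := by simp
    rw [happ, inner_add_left, real_inner_self_eq_norm_sq, sum_inner]
    have hq : ∀ j, Xo j * (rc j * z 0 + rs j * z 1) ^ 2 + Xi j * (-rs j * z 0 + rc j * z 1) ^ 2 ≤ ⟪A j z, z⟫_ℝ := by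
      intro j
      obtain ⟨a0, a1⟩ := hAapp j z
      rw [euclid2_inner, a0, a1]
      have e : (rc j * ((Real.exp (Xo j) - 1) * (rc j * z 0 + rs j * z 1)) -
            rs j * ((Real.exp (Xi j) - 1) * (-rs j * z 0 + rc j * z 1))) * z 0 +
          (rs j * ((Real.exp (Xo j) - 1) * (rc j * z 0 + rs j * z 1)) +
            rc j * ((Real.exp (Xi j) - 1) * (-rs j * z 0 + rc j * z 1))) * z 1 =
          (Real.exp (Xo j) - 1) * (rc j * z 0 + rs j * z 1) ^ 2 + (Real.exp (Xi j) - 1) * (-rs j * z 0 + rc j * z 1) ^ 2 := by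
        ring
      rw [e]
      have ho : Xo j ≤ Real.exp (Xo j) - 1 := by linarith [Real.add_one_le_exp (Xo j)]
      have hi : Xi j ≤ Real.exp (Xi j) - 1 := by linarith [Real.add_one_le_exp (Xi j)]
      have t1 := mul_le_mul_of_nonneg_right ho (sq_nonneg (rc j * z 0 + rs j * z 1))
      have t2 := mul_le_mul_of_nonneg_right hi (sq_nonneg (-rs j * z 0 + rc j * z 1))
      linarith
    have hsum := Finset.sum_le_sum fun j (_ : j ∈ Finset.univ) => hq j
    have hI := hiso (z 0) (z 1)
    rw [euclid2_norm_sq]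
    linarith [hsum, hI]
  have hmain' : (1 + μ) * ‖z‖ ≤ ‖(1 + ∑ j, A j) z‖ := by
    by_cases hz0' : ‖z‖ = 0
    · rw [hz0', mul_zero]; exact norm_nonneg _
    · have hzpos : 0 < ‖z‖ := lt_of_le_of_ne (norm_nonneg _) (Ne.symm hz0')
      have hcs := real_inner_le_norm ((1 + ∑ j, A j) z) z
      nlinarith [hmain, hcs, hzpos]
  -- (d) second-order expansion of the ordered product
  have hlist : (List.ofFn fun i : Fin k₀ => Nop i) = (List.ofFn fun j : Fin k₀ => -A j).map fun B => 1 - B := by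
    rw [List.map_ofFn]
    congr 1
    funext j
    rw [hA]
    simp only [Function.comp_apply, sub_neg_eq_add, add_sub_cancel]
  have hnorms : ((List.ofFn fun j : Fin k₀ => -A j).map fun B => ‖B‖).sum = ∑ j, ‖A j‖ := by
    rw [List.map_ofFn, List.sum_ofFn]; simp only [Function.comp_apply, norm_neg]
  have hsumA : (List.ofFn fun j : Fin k₀ => -A j).sum = -∑ j, A j := by
    rw [List.sum_ofFn, Finset.sum_neg_distrib]
  have hAS : ∑ j, ‖A j‖ ≤ S := by rw [hS]; exact Finset.sum_le_sum fun j _ => hAnorm j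
  have hA0 : 0 ≤ ∑ j, ‖A j‖ := Finset.sum_nonneg fun j _ => norm_nonneg _
  have hrem := norm_listProd_one_sub_sub_le (List.ofFn fun j : Fin k₀ => -A j) (by rw [hnorms]; exact hAS.trans hsmallX)
  rw [hnorms, hsumA, sub_neg_eq_add, ← hlist] at hrem
  -- (e) combine
  obtain ⟨p0, p1⟩ := hprod k₀ le_rfl z
  have hTz : ‖(List.ofFn fun i : Fin k₀ => Nop i).prod z‖ ^ 2 = (c₁₁ k₀ * z₁ + c₁₂ k₀ * z₂) ^ 2 + (c₂₁ k₀ * z₁ + c₂₂ k₀ * z₂) ^ 2 := by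
    rw [euclid2_norm_sq, p0, p1, hz0, hz1]
  have hdiff : ‖((List.ofFn fun i : Fin k₀ => Nop i).prod - (1 + ∑ j, A j)) z‖ ≤ S ^ 2 * ‖z‖ := by
    refine (ContinuousLinearMap.le_opNorm _ _).trans (mul_le_mul_of_nonneg_right ?_ (norm_nonneg _))
    exact hrem.trans (pow_le_pow_left₀ hA0 hAS 2)
  have htri : ‖(1 + ∑ j, A j) z‖ ≤ ‖(List.ofFn fun i : Fin k₀ => Nop i).prod z‖ +
      ‖((List.ofFn fun i : Fin k₀ => Nop i).prod - (1 + ∑ j, A j)) z‖ := by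
    have e : (1 + ∑ j, A j) z = (List.ofFn fun i : Fin k₀ => Nop i).prod z -
        ((List.ofFn fun i : Fin k₀ => Nop i).prod - (1 + ∑ j, A j)) z := by
      simp
    rw [e]
    exact norm_sub_le _ _
  have hlow : (1 + μ - S ^ 2) * ‖z‖ ≤ ‖(List.ofFn fun i : Fin k₀ => Nop i).prod z‖ := by
    linarith [hmain', htri, hdiff]
  have hsq := pow_le_pow_left₀ (mul_nonneg hpos (norm_nonneg z)) hlow 2
  rw [mul_pow, hTz, euclid2_norm_sq, hz0, hz1] at hsq
  exact hsq

end Summit.AnomalousDissipation.AnomalousDissipation.Theorems.SolenoidalFractalHomogenisation.RealisedQuasiStaticCellLaw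

end
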